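import Mathlib
import HarnessLib
import Literature.Analysis.FluidPDE.NSBoundedMildAnalytic
import Summits.NavierStokesRegularity.NavierStokesRegularity.Theorems.UnthreadedRigidityDoorUnthreadedRigidityVirialHornWindowAxisUniform

/-!
# Route `UnthreadedRigidityDoor`, item `UnthreadedRigidity` (W2, stmt-NavierStokesRegularity-27585) — LINE g11-1 «VIRIAL HORN»:
# INTERIOR REGULARITY OF A WINDOW (the «M» input of the bridges W and V-W)

Under the window hypotheses of the crux `UnthreadedRigidity` VERBATIM (open time set `S`, `u` jointly continuous on `S × ℝ³`,
the Oseen integral identity `u(t) = e^{(t−s)Δ}u(s) − B¹ₛ(u,u)(t)` pointwise for `s < t` in `S`, a sup bound on every sub-window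
`S ∩ (−∞, τ]`; neither divergence-freeness nor preconnectedness is used):

* `window_smooth_strip`, `window_isSmoothSpaceTimeOn` — `u` is JOINTLY `C^∞` on `S × ℝ³` (`IsSmoothSpaceTimeOn S u`): near each
  `t ∈ S` the field IS the canonical representative of KNSS 2009, Prop. 4.1 (`knss2009_smoothing_holds`);
* `window_analytic_strip`, `window_analyticOnNhd`, `window_analyticOnNhd_slice` — `u` is JOINTLY REAL-ANALYTIC on `S × ℝ³`
  (`AnalyticOnNhd ℝ (uncurry u) (S ×ˢ univ)`), in particular every slice `u t`, `t ∈ S`, is real-analytic on `ℝ³`: near each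
  `t ∈ S`, restarting at a time `s < t` within the analytic lifespan `ε/M²` of Lemarié-Rieusset's Thm. 9.12
  (`lemarieRieusset2016_local_analyticity_holds`), the local analytic solution from `u(s)` coincides with `u`
  (`oseenMild_bounded_unique` + continuity of both).

These are the «M» (interior regularity / analyticity) inputs named in the docstrings of BRIDGE W `WindowWedgeAnalyticL` («interior
space-analyticity of bounded mild solutions ⇒ the coefficient profiles of a slice are analytic») and BRIDGE V-W `VirialWindowSilence`
(«interior time-smoothness ⇒ every jet of the identically vanishing flux vanishes at interior times»); the bridges themselves are NOT
proved here.  HONEST LABEL: regularity bookkeeping for one RUNG line; `UnthreadedRigidity` (27585), W2 and NS regularity remain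
OPEN; nothing here is a statement about regularity of (possibly singular) Navier–Stokes solutions beyond the KNSS / Lemarié-Rieusset
interior theory already in the tree.  `--supports stmt-NavierStokesRegularity-27585` (helper); ns-crc-p2 g8.
[cite: KochNadirashviliSereginSverak2009, Prop. 4.1 (arXiv:0709.3599 p. 8); LemarieRieusset2016, Thm. 9.12 (PDF p. 260)]
-/

-- the summit and its single sub-problem share the name (CONVENTIONS §1)
set_option linter.dupNamespace false

namespace Summit.NavierStokesRegularity.NavierStokesRegularity.Theorems.UnthreadedRigidity.VirialHorn

open scoped Topology
open Filter Set MeasureTheory Function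
open Summit.NavierStokesRegularity.NavierStokesRegularity.Theorems.UnthreadedRigidity.ProfileHorn (E3)
open Literature.Analysis.FluidPDE Literature.Analysis.UnboundedOperators

/-! ## §1 Joint smoothness -/

/-- SMOOTH STRIP: every `t ∈ S` lies in a strip `(s, T') ⊆ S` on which `u` is jointly `C^∞` (it is the canonical representative
`e^{(·−s)Δ}u(s) − B¹ₛ(u,u)` there, jointly smooth by KNSS smoothing). [cite: KochNadirashviliSereginSverak2009, Prop. 4.1 (arXiv:0709.3599 p. 8)] -/
theorem window_smooth_strip {S : Set ℝ} (hS : IsOpen S) {u : ℝ → E3 → E3}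
    (hcont : ContinuousOn (uncurry u) (S ×ˢ univ))
    (hmild : ∀ s ∈ S, ∀ t ∈ S, s < t → ∀ x, u t x =
        heatExtension (u s) (t - s) x - oseenDuhamel 1 s u u t x)
    (hbdd : ∀ τ ∈ S, ∃ B : ℝ, ∀ t ∈ S, t ≤ τ → ∀ x, ‖u t x‖ ≤ B)
    {t : ℝ} (ht : t ∈ S) :
    ∃ s T' : ℝ, s < t ∧ t < T' ∧ Ioo s T' ⊆ S ∧ IsSmoothSpaceTimeOn (Ioo s T') u := by
  obtain ⟨s, hst, hsI⟩ := exists_lt_Icc_subset hS ht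
  obtain ⟨T', htT', htI⟩ := exists_gt_Icc_subset hS ht
  have hsS : s ∈ S := hsI ⟨le_rfl, hst.le⟩
  have hT'S : T' ∈ S := htI ⟨htT'.le, le_rfl⟩
  have hIoo : Ioo s T' ⊆ S := fun r hr => by
    rcases le_or_gt r t with h | h
    · exact hsI ⟨hr.1.le, h⟩
    · exact htI ⟨h.le, hr.2.le⟩
  obtain ⟨B, hB⟩ := hbdd T' hT'S
  have hM0 : (0 : ℝ) ≤ max B 0 := le_max_right _ _
  have hbound : ∀ τ ∈ S, τ ≤ T' → ∀ x, ‖u τ x‖ ≤ max B 0 :=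
    fun τ hτ hle x => (hB τ hτ hle x).trans (le_max_left _ _)
  have hslice : ∀ τ ∈ S, Continuous (u τ) := fun τ hτ =>
    hcont.comp_continuous (continuous_const.prodMk continuous_id) fun x => ⟨hτ, mem_univ _⟩
  have ha : AEStronglyMeasurable (u s) volume := (hslice s hsS).aestronglyMeasurable
  have haM : eLpNorm (u s) ⊤ volume ≤ ENNReal.ofReal (max B 0) := by
    rw [eLpNorm_exponent_top]
    exact eLpNormEssSup_le_of_ae_bound
      (Eventually.of_forall fun x => hbound s hsS (hst.le.trans htT'.le) x)
  have hum : AEStronglyMeasurable (uncurry u) (volume.restrict (Ioo s T' ×ˢ univ)) :=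
    (hcont.mono (prod_mono hIoo Subset.rfl)).aestronglyMeasurable
      (measurableSet_Ioo.prod MeasurableSet.univ)
  have huM : ∀ τ ∈ Ioo s T', eLpNorm (u τ) ⊤ volume ≤ ENNReal.ofReal (max B 0) := fun τ hτ => by
    rw [eLpNorm_exponent_top]
    exact eLpNormEssSup_le_of_ae_bound (Eventually.of_forall fun x => hbound τ (hIoo hτ) hτ.2.le x)
  have husol : ∀ τ ∈ Ioo s T', u τ =ᵐ[volume] fun x =>
      heatExtension (u s) (1 * (τ - s)) x - oseenDuhamel 1 s u u τ x := fun τ hτ =>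
    Eventually.of_forall fun x => by rw [one_mul]; exact hmild s hsS τ (hIoo hτ) hτ.1 x
  obtain ⟨hsm, -, -⟩ :=
    knss2009_smoothing_holds E3 one_pos (hst.trans htT') hM0 ha haM hum huM husol
  refine ⟨s, T', hst, htT', hIoo, ?_⟩
  refine ContDiffOn.congr hsm ?_
  rintro ⟨τ, x⟩ hp
  show u τ x = heatExtension (u s) (1 * (τ - s)) x - oseenDuhamel 1 s u u τ x
  rw [one_mul]
  exact hmild s hsS τ (hIoo hp.1) hp.1.1 x

/-- JOINT SMOOTHNESS OF A WINDOW: under the window hypotheses of `UnthreadedRigidity` (continuity, the pointwise Oseen identity,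
the local sup bound) `u` is jointly `C^∞` on `S × ℝ³`. [cite: KochNadirashviliSereginSverak2009, Prop. 4.1 (arXiv:0709.3599 p. 8)] -/
theorem window_isSmoothSpaceTimeOn {S : Set ℝ} (hS : IsOpen S) {u : ℝ → E3 → E3}
    (hcont : ContinuousOn (uncurry u) (S ×ˢ univ))
    (hmild : ∀ s ∈ S, ∀ t ∈ S, s < t → ∀ x, u t x =
        heatExtension (u s) (t - s) x - oseenDuhamel 1 s u u t x)
    (hbdd : ∀ τ ∈ S, ∃ B : ℝ, ∀ t ∈ S, t ≤ τ → ∀ x, ‖u t x‖ ≤ B) :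
    IsSmoothSpaceTimeOn S u := by
  rintro ⟨t, x⟩ hp
  obtain ⟨s, T', hst, htT', -, hsm⟩ := window_smooth_strip hS hcont hmild hbdd hp.1
  exact (IsSmoothSpaceTimeOn.contDiffAt hsm isOpen_Ioo ⟨hst, htT'⟩ x).contDiffWithinAt

/-! ## §2 Joint real-analyticity -/

/-- ANALYTIC STRIP: every `t ∈ S` lies in a strip `(s, T'') ⊆ S` on which `u` is jointly real-analytic — restart at a time
`s < t` within the analytic lifespan `ε/M²` of the local analytic solution from the bounded datum `u(s)`
(`lemarieRieusset2016_local_analyticity_holds`), which coincides with `u` by forward uniqueness of bounded solutions of the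
Oseen equation and continuity. [cite: LemarieRieusset2016, Thm. 9.12 (PDF p. 260)] -/
theorem window_analytic_strip {S : Set ℝ} (hS : IsOpen S) {u : ℝ → E3 → E3}
    (hcont : ContinuousOn (uncurry u) (S ×ˢ univ))
    (hmild : ∀ s ∈ S, ∀ t ∈ S, s < t → ∀ x, u t x =
        heatExtension (u s) (t - s) x - oseenDuhamel 1 s u u t x)
    (hbdd : ∀ τ ∈ S, ∃ B : ℝ, ∀ t ∈ S, t ≤ τ → ∀ x, ‖u t x‖ ≤ B)
    {t : ℝ} (ht : t ∈ S) :
    ∃ s T'' : ℝ, s < t ∧ t < T'' ∧ Ioo s T'' ⊆ S ∧ AnalyticOnNhd ℝ (uncurry u) (Ioo s T'' ×ˢ univ) := by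
  obtain ⟨ε, hε, C, hC0, hloc⟩ := lemarieRieusset2016_local_analyticity_holds
  obtain ⟨s₀, hs₀t, hs₀I⟩ := exists_lt_Icc_subset hS ht
  obtain ⟨T', htT', htI⟩ := exists_gt_Icc_subset hS ht
  have hT'S : T' ∈ S := htI ⟨htT'.le, le_rfl⟩
  obtain ⟨B, hB⟩ := hbdd T' hT'S
  set M : ℝ := max B 1 with hM
  have hM0 : 0 < M := lt_of_lt_of_le one_pos (le_max_right _ _)
  have hBM : B ≤ M := le_max_left _ _
  have hδ : 0 < ε / M ^ 2 := div_pos hε (pow_pos hM0 2)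
  -- restart time `s`, close enough below `t`
  set s : ℝ := max s₀ (t - ε / M ^ 2 / 2) with hs
  have hst : s < t := max_lt hs₀t (by linarith)
  have hts : t < s + ε * 1 / M ^ 2 := by
    have : t - ε / M ^ 2 / 2 ≤ s := le_max_right _ _
    rw [mul_one]
    linarith
  have hsI : Icc s t ⊆ S := fun r hr => hs₀I ⟨(le_max_left _ _).trans hr.1, hr.2⟩
  have hsS : s ∈ S := hsI ⟨le_rfl, hst.le⟩
  set T'' : ℝ := min (s + ε * 1 / M ^ 2) T' with hT''
  have htT'' : t < T'' := lt_min hts htT'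
  have hIoo : Ioo s T'' ⊆ S := fun r hr => by
    rcases le_or_gt r t with h | h
    · exact hsI ⟨hr.1.le, h⟩
    · exact htI ⟨h.le, (hr.2.trans_le (min_le_right _ _)).le⟩
  have hslice : ∀ τ ∈ S, Continuous (u τ) := fun τ hτ =>
    hcont.comp_continuous (continuous_const.prodMk continuous_id) fun x => ⟨hτ, mem_univ _⟩
  have ha : AEStronglyMeasurable (u s) volume := (hslice s hsS).aestronglyMeasurable
  have haM : eLpNorm (u s) ⊤ volume ≤ ENNReal.ofReal M := by
    rw [eLpNorm_exponent_top]
    exact eLpNormEssSup_le_of_ae_bound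
      (Eventually.of_forall fun x => (hB s hsS (hst.le.trans htT'.le) x).trans hBM)
  obtain ⟨v, hva, hvsol, hvbd⟩ := hloc one_pos s hM0 ha haM
  -- forward uniqueness on `(s, T'')`
  have hM'0 : (0 : ℝ) ≤ max M (C * M) := hM0.le.trans (le_max_left _ _)
  have hIooW : Ioo s T'' ⊆ Ioo s (s + ε * 1 / M ^ 2) := fun r hr => ⟨hr.1, hr.2.trans_le (min_le_left _ _)⟩
  have hum : AEStronglyMeasurable (uncurry u) ((volume : Measure (ℝ × E3)).restrict (Ioo s T'' ×ˢ univ)) :=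
    (hcont.mono (prod_mono hIoo Subset.rfl)).aestronglyMeasurable (measurableSet_Ioo.prod MeasurableSet.univ)
  have hvc : ContinuousOn (uncurry v) (Ioo s T'' ×ˢ univ) :=
    hva.continuousOn.mono (prod_mono hIooW Subset.rfl)
  have hvm : AEStronglyMeasurable (uncurry v) ((volume : Measure (ℝ × E3)).restrict (Ioo s T'' ×ˢ univ)) :=
    hvc.aestronglyMeasurable (measurableSet_Ioo.prod MeasurableSet.univ)
  have huM : ∀ τ ∈ Ioo s T'', ∀ x, ‖u τ x‖ ≤ max M (C * M) := fun τ hτ x =>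
    ((hB τ (hIoo hτ) (hτ.2.le.trans (min_le_right _ _)) x).trans hBM).trans (le_max_left _ _)
  have hvM : ∀ τ ∈ Ioo s T'', ∀ x, ‖v τ x‖ ≤ max M (C * M) := fun τ hτ x =>
    (hvbd τ (hIooW hτ) x).trans (le_max_right _ _)
  have husol : ∀ τ ∈ Ioo s T'', u τ =ᵐ[volume] fun x =>
      heatExtension (u s) (1 * (τ - s)) x - oseenDuhamel 1 s u u τ x := fun τ hτ =>
    Eventually.of_forall fun x => by rw [one_mul]; exact hmild s hsS τ (hIoo hτ) hτ.1 x
  have hvsol' : ∀ τ ∈ Ioo s T'', v τ =ᵐ[volume] fun x =>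
      heatExtension (u s) (1 * (τ - s)) x - oseenDuhamel 1 s v v τ x := fun τ hτ =>
    Eventually.of_forall fun x => hvsol τ (hIooW hτ) x
  have huniq := oseenMild_bounded_unique (E := E3)
    (U := fun τ x => heatExtension (u s) (1 * (τ - s)) x) one_pos hM'0 hum hvm huM hvM husol hvsol'
  have heq : ∀ τ ∈ Ioo s T'', u τ = v τ := fun τ hτ =>
    Measure.eq_of_ae_eq (huniq τ hτ) (hslice τ (hIoo hτ))
      (hvc.comp_continuous (continuous_const.prodMk continuous_id) fun x => ⟨hτ, mem_univ _⟩)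
  refine ⟨s, T'', hst, htT'', hIoo, ?_⟩
  rintro ⟨τ, x⟩ hp
  have hopen : IsOpen (Ioo s T'' ×ˢ (univ : Set E3)) := isOpen_Ioo.prod isOpen_univ
  have hv_at : AnalyticAt ℝ (uncurry v) (τ, x) := hva (τ, x) ⟨hIooW hp.1, mem_univ _⟩
  refine hv_at.congr ?_
  filter_upwards [hopen.mem_nhds hp] with q hq
  show uncurry v q = uncurry u q
  rcases q with ⟨τ', x'⟩
  show v τ' x' = u τ' x'
  rw [heq τ' hq.1]

/-- JOINT REAL-ANALYTICITY OF A WINDOW: under the window hypotheses of `UnthreadedRigidity`, `u` is jointly real-analytic on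
`S × ℝ³`. [cite: LemarieRieusset2016, Thm. 9.12 (PDF p. 260)] -/
theorem window_analyticOnNhd {S : Set ℝ} (hS : IsOpen S) {u : ℝ → E3 → E3}
    (hcont : ContinuousOn (uncurry u) (S ×ˢ univ))
    (hmild : ∀ s ∈ S, ∀ t ∈ S, s < t → ∀ x, u t x =
        heatExtension (u s) (t - s) x - oseenDuhamel 1 s u u t x)
    (hbdd : ∀ τ ∈ S, ∃ B : ℝ, ∀ t ∈ S, t ≤ τ → ∀ x, ‖u t x‖ ≤ B) :
    AnalyticOnNhd ℝ (uncurry u) (S ×ˢ univ) := by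
  rintro ⟨t, x⟩ hp
  obtain ⟨s, T'', hst, htT'', -, han⟩ := window_analytic_strip hS hcont hmild hbdd hp.1
  exact han (t, x) ⟨⟨hst, htT''⟩, mem_univ _⟩

/-- ANALYTIC SLICES: under the window hypotheses of `UnthreadedRigidity`, every slice `u t`, `t ∈ S`, is real-analytic on `ℝ³`
(the «interior space-analyticity» input of BRIDGE W). [cite: LemarieRieusset2016, Thm. 9.12 (PDF p. 260)] -/
theorem window_analyticOnNhd_slice {S : Set ℝ} (hS : IsOpen S) {u : ℝ → E3 → E3}
    (hcont : ContinuousOn (uncurry u) (S ×ˢ univ))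
    (hmild : ∀ s ∈ S, ∀ t ∈ S, s < t → ∀ x, u t x =
        heatExtension (u s) (t - s) x - oseenDuhamel 1 s u u t x)
    (hbdd : ∀ τ ∈ S, ∃ B : ℝ, ∀ t ∈ S, t ≤ τ → ∀ x, ‖u t x‖ ≤ B)
    {t : ℝ} (ht : t ∈ S) : AnalyticOnNhd ℝ (u t) univ := by
  intro x _
  have hj : AnalyticAt ℝ (uncurry u) (t, x) := window_analyticOnNhd hS hcont hmild hbdd (t, x) ⟨ht, mem_univ _⟩
  have hι : AnalyticAt ℝ (fun y : E3 => ((t, y) : ℝ × E3)) x := analyticAt_const.prod analyticAt_id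
  exact hj.comp hι

end Summit.NavierStokesRegularity.NavierStokesRegularity.Theorems.UnthreadedRigidity.VirialHorn
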